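import Summits.QuantumFields.BalabanUV.T4Continuum.Spine.NE3.LandauProjectionSupCurvedUniform
import Summits.QuantumFields.BalabanUV.T4Continuum.Spine.NE3.LandauCorrectionSupB8Cavg
import HarnessLib

/-!
# T⁴ programme, node NE3 — census R40 (file (v), CAPSTONE): THE END's SUP LETTER `hK` AT A CURVED BACKGROUND — IN PARTICULAR AT `W = cavg L U_B` — FROM THE TWO
# REGULARITY RADII ALONE (no (H0_W), no (HR_W) binder left)

Cell `pub-balaban-gaps` (YM blitz, track G2, seat `ne3`, unit `pub-balaban-gaps-ne3-g9`; writer prover-pub-balaban-gaps-ne3-g9-0, 2026-08-25), census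
`run/shared/lean/pub/pub-balaban-gaps/ne/NE3.md` §4 R40, §15.  WHY.  Gen 8 reduced THE END's per-pair sup letter `hK` at the averaged background `W = cavg L U_B` to
(HR_W) + sup-regularity radii of `U_B` (`LandauCorrectionSupB8Cavg.landauCorrectionSupB8_cavg`, binder `hRW`); `LandauProjectionSupCurvedUniform.hRW_of_radii` proves
that binder from the same radii.  THIS FILE does the plugging:

* §3 **`landauCorrectionSupB8_curved`** — `LandauCorrectionSupB8 hL j hWu hx hs hWx N hθ K₀ K₁` at EVERY background `W` of the class from the two radii ALONE
  (gen 8's `SupRegularityCurvedUniform.landauCorrectionSupB8_uniform` with (HR_W) discharged), `K₀, K₁` depending on `d, L, card n, N` and the level-free product `M²x` only.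
* §4 **`landauCorrectionSupB8_cavg_of_regularSup`** — THE END's binder `hF5` at `W = cavg L U_B`, UNIFORM `K₀, K₁`, ⇐ `RegularSup d L N b c (j+2) U_B` ∧ (Rb) ∧
  `23040d⁴(frameC+d)²ε ≤ 1` ∧ `23040d⁴(frameC+d)³(c + curConst b²) ≤ 1` — NOTHING ELSE (gen 8's `landauCorrectionSupB8_cavg` with (HR_W) discharged).

CONTENT (0 sorry; no `def`; [folklore] bookkeeping over landed theorems BY NAME).  HONEST FRAMING.  This settles census R34∕R39∕R40 for the sup letter: THE END's
hypothesis SHAPE `hK` (per pair, at the averaged background) follows from a [B11] Thm 1 (10)-TYPE sup-regularity datum of `U_B` plus two numerical smallness lines; the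
companion `PairLandauB8EndSfClassH3sup` wires it into THE END through route (A)'s leaf (H3ˢᵘᵖ).  Nothing of Bałaban's asserted; (P♮) at curved `W` ([B9] Thm 3.3 TYPE),
`PairLandauGaugeB8Avg`, the covariant root and **NE3 are NOT proved**; spine PROVED 0∕9; finite T⁴ rung (B)+1 — NOT infinite volume, NOT mass gap, NOT `BetaPertH`,
NOT Clay.  PLACEMENT: `Summits/QuantumFields/BalabanUV/T4Continuum/Spine/NE3/`; imports accepted modules only; moves nothing.  HONEST DEPENDENCY (cell page 1):
continuum YM on T⁴ ⇐ BetaPertH ∧ nine spine estimates (0/9 proved); BetaPertH ⇐ (D1) ∧ (D4) ∧ CAP+tail; G-an2-4 gates asym, D1 and NE2/3/4.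
-/

set_option autoImplicit false

open scoped BigOperators Matrix Matrix.Norms.L2Operator
open NormedSpace Finset

namespace Summit.QuantumFields.BalabanUV.T4Continuum.NE3.LandauCorrectionSupB8Curved

open Literature.MathematicalPhysics.QuantumFieldTheory.Balaban1983to89
open B7Prop1Explicit B7Prop2Explicit MatrixNorms
open T4AveragingDeficitWall (Ad IsUnitaryCfg SmallField)
open T4AveragingDeficitWallBoundary (IsPeriodicCfg periodBox)
open AveragingDeficitMultiLevelPrep (LevelSmall)
open AveragingDeficitChartCalculus (cavg)
open MinimalActionRefine (RegularSup)
open BlockAverageCurrent (curConst curConst_nonneg)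
open NE3QbarIterCovLiftPrep (cruxC liftC)
open NE3CovariantCalculus (hsR)
open NE3RightInverseSupLetters (frameC)
open NE3.PairLandauB8 (avgKernelGauges covLapSite)
open NE3.LandauProjectionSupShape (LandauCorrectionSupB8)
open NE3.SupRegularityCurvedUniform (landauCorrectionSupB8_uniform)
open NE3AveragedGradientRadius (norm_plaqGrad_cavg_le_of_regularSup)
open NE3.LandauCorrectionSupB8Cavg (isPeriodicCfg_cavg landauCorrectionSupB8_cavg)
open NE3.LandauProjectionSupCurvedUniform (hRW_of_radii)

noncomputable section

variable {d : ℕ} {n : Type*} [Fintype n] [DecidableEq n]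

/-! ## §3 THE END's `hK` at a curved background of the class from the two radii alone -/

/-- **THE END's SUP LETTER `hK` AT A CURVED BACKGROUND OF THE CLASS FROM THE TWO REGULARITY RADII ALONE** (`d ≥ 1`, `L ≥ 2`, `N ≥ 1`, `j`; `M = L^{j+1}`,
`F = frameC d L + d`, `θ = cruxC·M²x < 1`): for unitary `(N·M)`-periodic `W` with `LevelSmall d L j x`, `SmallField W x`, covariant plaquette gradients `≤ x₁`, and
the two LEVEL-FREE lines `23040·d⁴F²·M²x ≤ 1`, `11520·d⁴F³·M³x₁ ≤ 1`: `LandauCorrectionSupB8 hL j hWu hx hs hWx N hθ K₀ K₁` with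
`K₀ = d·liftC·(6 + 2(d+1)M²x)·36dF²·c_R∕(1−θ)`, `K₁ = d·liftC·(6 + 2(d+1)M²x)·36dF·c_R∕(1−θ)`, `c_R = 1 + 2·card n·(64d²N)^d + 27(card n)³512^dN^d` — gen 8's
`landauCorrectionSupB8_uniform` with BOTH binders ((H0_W), (HR_W)) discharged into kinematics. [folklore] -/
theorem landauCorrectionSupB8_curved [Nonempty n] (hd : 1 ≤ d) {L : ℕ} (hL : 2 ≤ L) (j : ℕ)
    {W : Site d → Fin d → (Matrix n n ℂ)ˣ} {x x₁ : ℝ} (hWu : IsUnitaryCfg W) (hx : 0 ≤ x) (hs : LevelSmall d L j x) (hWx : SmallField W x)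
    (N : ℕ) [NeZero N] (hθ : cruxC d L * (((L : ℝ) ^ (j + 1)) ^ 2 * x) < 1) (hWP : IsPeriodicCfg W ((N * L ^ (j + 1) : ℕ) : ℤ)) (hx10 : 0 ≤ x₁)
    (hgrad : ∀ (p : Site d) (μ κ : Fin d), κ ≠ μ →
      ‖Ad (W p μ) ((hol W (p + e μ) (plaqWord κ μ) : (Matrix n n ℂ)ˣ) : Matrix n n ℂ) - ((hol W p (plaqWord κ μ) : (Matrix n n ℂ)ˣ) : Matrix n n ℂ)‖ ≤ x₁)
    (hbx : 23040 * (d : ℝ) ^ 4 * (frameC d L + d) ^ 2 * ((L : ℝ) ^ (j + 1)) ^ 2 * x ≤ 1)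
    (hcx : 11520 * (d : ℝ) ^ 4 * (frameC d L + d) ^ 3 * ((L : ℝ) ^ (j + 1)) ^ 3 * x₁ ≤ 1) :
    LandauCorrectionSupB8 hL j hWu hx hs hWx N hθ
      ((d : ℝ) * liftC d * (6 + 2 * ((d : ℝ) + 1) * (((L : ℝ) ^ (j + 1)) ^ 2 * x)) * (36 * d * (frameC d L + d) ^ 2)
        * (1 + 2 * (Fintype.card n : ℝ) * (64 * (d : ℝ) ^ 2 * N) ^ d + 27 * (Fintype.card n : ℝ) ^ 3 * (512 : ℝ) ^ d * (N : ℝ) ^ d)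
        / (1 - cruxC d L * (((L : ℝ) ^ (j + 1)) ^ 2 * x)))
      ((d : ℝ) * liftC d * (6 + 2 * ((d : ℝ) + 1) * (((L : ℝ) ^ (j + 1)) ^ 2 * x)) * (36 * d * (frameC d L + d))
        * (1 + 2 * (Fintype.card n : ℝ) * (64 * (d : ℝ) ^ 2 * N) ^ d + 27 * (Fintype.card n : ℝ) ^ 3 * (512 : ℝ) ^ d * (N : ℝ) ^ d)
        / (1 - cruxC d L * (((L : ℝ) ^ (j + 1)) ^ 2 * x))) :=
  landauCorrectionSupB8_uniform hd hL j hWu hx hs hWx N hθ hWP hx10 hgrad hbx hcx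
    (hRW_of_radii hd hL j hWu hWP hx hs hWx hx10 hgrad hbx hcx)

/-! ## §4 THE END's `hF5` at `W = cavg L U_B` from sup-regularity of `U_B` alone -/

/-- **THE END's PER-PAIR `hK` AT `W = cavg L U_B` FROM SUP-REGULARITY OF `U_B` ALONE** (`d ≥ 1`, `L ≥ 2`, `N ≥ 1`, `j`; letters of the binder `hF5` of
`PairLandauB8EndSfClassB8.ne3EnergyRateWCov_sfClass_B8`, `x = ε∕(L^{j+1})²`): `RegularSup d L N b c (j+2) U_B` ∧ (Rb) `2^15(d+1)²(d+4)²L²b ≤ 1` ∧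
`23040d⁴(frameC+d)²ε ≤ 1` ∧ `23040d⁴(frameC+d)³(c + curConst b²) ≤ 1` ⟹ `LandauCorrectionSupB8 … (cavg L U_B) … K₀ K₁` with `K₀, K₁` UNIFORM in `j` (depending on
`d, L, card n, N, ε` only) — gen 8's `landauCorrectionSupB8_cavg` with its (HR_W) binder DISCHARGED.  Honest: the END as printed carries `Regular` (ℓ²) for `U_B`;
wiring this in needs the `RegularSup` antecedent (planner). [folklore] -/
theorem landauCorrectionSupB8_cavg_of_regularSup [Nonempty n] (hd : 1 ≤ d) {L N : ℕ} [NeZero N] (hL : 2 ≤ L) (j : ℕ)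
    {UB : Site d → Fin d → (Matrix n n ℂ)ˣ} {b c ε : ℝ} (hreg : RegularSup d L N b c (j + 2) UB) (hb : 0 ≤ b) (hc : 0 ≤ c)
    (hRb : 2 ^ 15 * ((d : ℝ) + 1) ^ 2 * ((d : ℝ) + 4) ^ 2 * (L : ℝ) ^ 2 * b ≤ 1)
    (hεF : 23040 * (d : ℝ) ^ 4 * (frameC d L + d) ^ 2 * ε ≤ 1)
    (hcF : 23040 * (d : ℝ) ^ 4 * (frameC d L + d) ^ 3 * (c + curConst d L * b ^ 2) ≤ 1)
    (hWu : IsUnitaryCfg (cavg L UB)) (hx : 0 ≤ ε / ((L : ℝ) ^ (j + 1)) ^ 2) (hs : LevelSmall d L j (ε / ((L : ℝ) ^ (j + 1)) ^ 2))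
    (hWx : SmallField (cavg L UB) (ε / ((L : ℝ) ^ (j + 1)) ^ 2))
    (hθ : cruxC d L * (((L : ℝ) ^ (j + 1)) ^ 2 * (ε / ((L : ℝ) ^ (j + 1)) ^ 2)) < 1) :
    LandauCorrectionSupB8 hL j hWu hx hs hWx N hθ
      ((d : ℝ) * liftC d * (6 + 2 * ((d : ℝ) + 1) * ε) * (36 * d * (frameC d L + d) ^ 2)
        * (1 + 2 * (Fintype.card n : ℝ) * (64 * (d : ℝ) ^ 2 * N) ^ d + 27 * (Fintype.card n : ℝ) ^ 3 * (512 : ℝ) ^ d * (N : ℝ) ^ d) / (1 - cruxC d L * ε))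
      ((d : ℝ) * liftC d * (6 + 2 * ((d : ℝ) + 1) * ε) * (36 * d * (frameC d L + d))
        * (1 + 2 * (Fintype.card n : ℝ) * (64 * (d : ℝ) ^ 2 * N) ^ d + 27 * (Fintype.card n : ℝ) ^ 3 * (512 : ℝ) ^ d * (N : ℝ) ^ d) / (1 - cruxC d L * ε)) := by
  have hL1 : 1 ≤ L := by omega
  have hM0 : (0 : ℝ) < (L : ℝ) ^ (j + 1) := by positivity
  have hMε : ((L : ℝ) ^ (j + 1)) ^ 2 * (ε / ((L : ℝ) ^ (j + 1)) ^ 2) = ε := by field_simp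
  -- the plaquette-gradient radius of `cavg L U_B` at level `j + 1`
  set x₁ : ℝ := 2 * (c + curConst d L * b ^ 2) / ((L : ℝ) ^ (j + 1)) ^ 3 with hx₁
  have hx10 : 0 ≤ x₁ := by have := curConst_nonneg (d := d) L; positivity
  have hgrad : ∀ (p : Site d) (μ κ : Fin d), κ ≠ μ →
      ‖Ad (cavg L UB p μ) ((hol (cavg L UB) (p + e μ) (plaqWord κ μ) : (Matrix n n ℂ)ˣ) : Matrix n n ℂ)
        - ((hol (cavg L UB) p (plaqWord κ μ) : (Matrix n n ℂ)ˣ) : Matrix n n ℂ)‖ ≤ x₁ :=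
    fun p μ κ hκμ => norm_plaqGrad_cavg_le_of_regularSup (k := j + 1) hL1 hreg hb hRb p μ hκμ
  have hbx : 23040 * (d : ℝ) ^ 4 * (frameC d L + d) ^ 2 * ((L : ℝ) ^ (j + 1)) ^ 2 * (ε / ((L : ℝ) ^ (j + 1)) ^ 2) ≤ 1 := by
    rw [mul_assoc (23040 * (d : ℝ) ^ 4 * (frameC d L + d) ^ 2), hMε]; exact hεF
  have hcx : 11520 * (d : ℝ) ^ 4 * (frameC d L + d) ^ 3 * ((L : ℝ) ^ (j + 1)) ^ 3 * x₁ ≤ 1 := by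
    have e1 : 11520 * (d : ℝ) ^ 4 * (frameC d L + d) ^ 3 * ((L : ℝ) ^ (j + 1)) ^ 3 * x₁
        = 23040 * (d : ℝ) ^ 4 * (frameC d L + d) ^ 3 * (c + curConst d L * b ^ 2) := by
      rw [hx₁]; field_simp; ring
    rw [e1]; exact hcF
  have hWP : IsPeriodicCfg (cavg L UB) ((N * L ^ (j + 1) : ℕ) : ℤ) := isPeriodicCfg_cavg hreg.periodic
  exact landauCorrectionSupB8_cavg hd hL j hreg hb hc hRb hεF hcF hWu hx hs hWx hθ
    (hRW_of_radii hd hL j hWu hWP hx hs hWx hx10 hgrad hbx hcx)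

end

end Summit.QuantumFields.BalabanUV.T4Continuum.NE3.LandauCorrectionSupB8Curved
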